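import Summits.AnomalousDissipation.AnomalousDissipation.Theorems.SawtoothPulseCascadeK1LocalisedCascadeAxisMomentPeriodic
import Summits.AnomalousDissipation.AnomalousDissipation.Theorems.SawtoothPulseCascadeK1LocalisedCascadeSpectralMoments
import Summits.AnomalousDissipation.AnomalousDissipation.Theorems.SawtoothPulseCascadeK1LocalisedCascadeZoneJunk

/-!
# K1loc, line `Spectral` / SeqCone — helper: THE PERIODIC-CELL MOMENT BOUND FOR A PROFILE READ OFF ONE COORDINATE

Helper file of the prover lane on the crux `K1LocalisedCascade` (stmt-AnomalousDissipation-19491), route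
`SawtoothPulseCascade` (glue seat k1loc-p3, item (g1) of ad-k1loc-p2's 00:10:52Z list).  The `ℓ¹` moments
`Σ_q wd(q)‖𝓕(x ↦ X(x_j))(q)‖` of the S-B assembly were so far charged with the sup-norm Sobolev–Wiener bound `‖X″‖∞/(4π√3)`
(`…SpectralMoments`), which for the cascade cut-offs is of order `Λ_j² = (2πN_j/δ_j)²`.  The cut-offs are `1/N_j`-periodic, so
their axis spectrum lives on `N_jℤ`, and their derivatives are supported in the corner zone of measure `O(M_jδ_j)`: feeding
`…AxisMomentPeriodic.tsum_moment_le_of_axis_periodic` with the `L²` norms of `X′, X″` over one period gives the DROP-IN variant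
`tsum_abs_mul_norm_mFourierCoeff_onCircle_le_periodic` / `tsum_modulus_mul_norm_mFourierCoeff_onCircle_le_periodic`:
`Σ_q ω(q)‖𝓕(X∘x_j)(q)‖ ≤ (ω₁/2π)(√(2Q)·√I₁ + √I₂/(Nπ√(2Q)))` for every `Q ≥ 1`, where `I₁ ≥ ∫₀¹X′²`, `I₂ ≥ ∫₀¹X″²`
(`integral_norm_sq_comp_eval_lift` transfers the torus `L²` norms to `(0,1]`).  No definitions; no statement about the stub.
[cite: Grafakos2014, Prop. 3.1.2 (5) and Prop. 3.2.7 (3)] [problem: turb]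
-/

-- `Summit.<Summit>.<Problem>`: single-conjunct summit, the duplicate namespace segment is deliberate.
set_option linter.dupNamespace false

noncomputable section

namespace Summit.AnomalousDissipation.AnomalousDissipation.Theorems.SawtoothPulseCascade.K1Slot

open MeasureTheory Set Filter Topology UnitAddTorus Complex
open Literature.Analysis Literature.Analysis.FunctionSpaces Literature.Analysis.FunctionSpaces.Torus
open Summit.AnomalousDissipation.AnomalousDissipation.Theorems.SawtoothPulseCascade.SpectralLeakage
open Summit.AnomalousDissipation.AnomalousDissipation.Theorems.SawtoothPulseCascade.K1Cutoff
open Summit.AnomalousDissipation.AnomalousDissipation.Theorems.SawtoothPulseCascade.K1Flat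
open scoped ContDiff

variable {d : Type*} [Fintype d] [DecidableEq d]

/-! ## Torus `L²` norms of a function read off one coordinate -/

omit [DecidableEq d] in
/-- **`∫_{𝕋^d} ‖F̃(x_j)‖² = ∫_{(0,1]} ‖F‖²`** for the periodic lift `F̃` of a continuous `1`-periodic `F : ℝ → ℂ`.
[cite: Grafakos2014, Prop. 3.2.7 (3)] -/
theorem integral_norm_sq_comp_eval_lift {F : ℝ → ℂ} (hp : Function.Periodic F 1) (hF : Continuous F) (j : d) :
    ∫ x : UnitAddTorus d, ‖(hp.lift : UnitAddCircle → ℂ) (x j)‖ ^ 2 = ∫ y in Ioc (0 : ℝ) 1, ‖F y‖ ^ 2 := by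
  have hlc : Continuous (hp.lift : UnitAddCircle → ℂ) := by
    have h : (hp.lift : UnitAddCircle → ℂ) ∘ (QuotientAddGroup.mk : ℝ → UnitAddCircle) = F := by
      funext x; exact hp.lift_coe x
    rw [(QuotientAddGroup.isQuotientMap_mk _).continuous_iff, h]
    exact hF
  have hG : Continuous fun b : UnitAddCircle => ‖(hp.lift : UnitAddCircle → ℂ) b‖ ^ 2 := (continuous_norm.comp hlc).pow 2
  rw [integral_comp_eval_eq_integral_circle hG j, ← UnitAddCircle.integral_preimage 0, zero_add]
  refine setIntegral_congr_fun measurableSet_Ioc fun y _ => ?_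
  simp only [hp.lift_coe]

/-! ## The periodic-cell Sobolev–Wiener bound -/

/-- **Periodic-cell Sobolev–Wiener bound for a profile read off `x_j`.**  If the profile `X` is `1/N`-periodic (`N ≥ 1`) and
`∫_{(0,1]} X′² ≤ I₁`, `∫_{(0,1]} X″² ≤ I₂`, then for every `Q ≥ 1`
`Σ_q |q_j|·‖𝓕(x ↦ X(x_j))(q)‖ ≤ (1/2π)(√(2Q)·√I₁ + √I₂/(N·π·√(2Q)))`, with the summability.
[cite: Grafakos2014, Prop. 3.1.2 (5) and Prop. 3.2.7 (3)] -/
theorem tsum_abs_mul_norm_mFourierCoeff_onCircle_le_periodic (X : ShearProfile) (j : d) {N : ℕ} (hN : 1 ≤ N)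
    (hXN : ∀ y, X (y + 1 / N) = X y) {I₁ I₂ : ℝ} (hI₁ : ∫ y in Ioc (0 : ℝ) 1, (deriv X y) ^ 2 ≤ I₁)
    (hI₂ : ∫ y in Ioc (0 : ℝ) 1, (deriv (deriv X) y) ^ 2 ≤ I₂) {Q : ℕ} (hQ : 1 ≤ Q) :
    (Summable fun q : d → ℤ => |(q j : ℝ)| * ‖mFourierCoeff (fun x : UnitAddTorus d => ((X.onCircle (x j) : ℝ) : ℂ)) q‖) ∧
    ∑' q : d → ℤ, |(q j : ℝ)| * ‖mFourierCoeff (fun x : UnitAddTorus d => ((X.onCircle (x j) : ℝ) : ℂ)) q‖ ≤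
      1 / (2 * Real.pi) * (Real.sqrt (2 * Q) * Real.sqrt I₁ + Real.sqrt I₂ / ((N : ℝ) * (Real.pi * Real.sqrt (2 * Q)))) := by
  classical
  -- the derivative family and its lifts (as in `…SpectralMoments`)
  have hXc : ContDiff ℝ ∞ (fun y => (X y : ℂ)) := ofRealCLM.contDiff.comp X.contDiff
  have hp0 : Function.Periodic (fun y => (X y : ℂ)) 1 := fun y => by simp only [X.periodic y]
  have hp : ∀ α, Function.Periodic (iteratedDeriv α (fun y => (X y : ℂ))) 1 := fun α => periodic_iteratedDeriv hp0 α
  have hd : ∀ α y, HasDerivAt (iteratedDeriv α (fun y => (X y : ℂ))) (iteratedDeriv (α + 1) (fun y => (X y : ℂ)) y) y := by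
    intro α y
    have hdiff : Differentiable ℝ (iteratedDeriv α (fun y => (X y : ℂ))) := by
      rw [iteratedDeriv_eq_iterate]; exact (hXc.iterate_deriv α).differentiable (by simp)
    rw [iteratedDeriv_succ]
    exact (hdiff y).hasDerivAt
  have hcs : ∀ α, ContDiff ℝ ∞ (iteratedDeriv α (fun y => (X y : ℂ))) := fun α => by
    rw [iteratedDeriv_eq_iterate]; exact hXc.iterate_deriv α
  have hc : ∀ α, Continuous (iteratedDeriv α (fun y => (X y : ℂ))) := fun α => (hcs α).continuous
  set Θ : ℕ → UnitAddTorus d → ℂ := fun α x => ((hp α).lift : UnitAddCircle → ℂ) (x j) with hΘ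
  have hrel : ∀ α q, mFourierCoeff (Θ α) q = (2 * Real.pi * I * (q j : ℂ)) ^ α * mFourierCoeff (Θ 0) q :=
    fun α q => mFourierCoeff_comp_eval_periodicLift_iterate hp hd hc j α q
  have hΘ0 : Θ 0 = fun x : UnitAddTorus d => ((X.onCircle (x j) : ℝ) : ℂ) := by
    funext x
    exact periodicLift_ofReal_eq_onCircle X (hp 0) (fun y => by rw [iteratedDeriv_zero]) (x j)
  have haxis : ∀ (q : d → ℤ) (l : d), l ≠ j → q l ≠ 0 → mFourierCoeff (Θ 0) q = 0 := by
    intro q l hl hq; rw [hΘ0]; exact mFourierCoeff_onCircle_eq_zero_of_ne X j hl hq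
  have hΘc : ∀ α, Continuous (Θ α) := fun α => (isSmooth_comp_eval_periodicLift (hp α) (hcs α) j).continuous
  have h1 : ∀ n : d → ℤ, mFourierCoeff (Θ 1) n = (2 * Real.pi * I * (n j)) * mFourierCoeff (Θ 0) n := fun n => by
    rw [hrel 1 n, pow_one]
  have h2 : ∀ n : d → ℤ, mFourierCoeff (Θ 2) n = (2 * Real.pi * I * (n j)) * mFourierCoeff (Θ 1) n := fun n => by
    rw [hrel 2 n, hrel 1 n]; ring
  -- periodicity along the axis: the spectrum of `Θ 0` lives on `Nℤ·e_j`
  have hN0 : (N : ℝ) ≠ 0 := by exact_mod_cast (by omega : N ≠ 0)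
  have hper : ∀ x : UnitAddTorus d, Θ 0 (x + Pi.single j (((1 : ℝ) / N : ℝ) : UnitAddCircle)) = Θ 0 x := by
    intro x
    simp only [hΘ, Pi.add_apply, Pi.single_eq_same]
    induction x j using QuotientAddGroup.induction_on with
    | H y =>
      rw [← QuotientAddGroup.mk_add, (hp 0).lift_coe, (hp 0).lift_coe, iteratedDeriv_zero, hXN]
  have hsupp : ∀ n : d → ℤ, mFourierCoeff (Θ 0) n ≠ 0 → (∀ l, l ≠ j → n l = 0) ∧ (N : ℤ) ∣ n j := by
    intro n hn
    refine ⟨fun l hl => ?_, ?_⟩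
    · by_contra hq; exact hn (haxis n l hl hq)
    · by_contra hdiv; exact hn (mFourierCoeff_eq_zero_of_axis_periodic hN hper hdiv)
  -- the axis-periodic moment bound with `ω(n) = |n_j|`, `L = 1`
  obtain ⟨hs, hle⟩ := tsum_moment_le_of_axis_periodic (hΘc 1) (hΘc 2) j hN hsupp h1 h2 (L := 1) zero_le_one
    (fun n : d → ℤ => (abs_nonneg _ : (0 : ℝ) ≤ |((n j : ℤ) : ℝ)|))
    (fun n : d → ℤ => (le_of_eq (one_mul _).symm : |((n j : ℤ) : ℝ)| ≤ 1 * |((n j : ℤ) : ℝ)|)) hQ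
  rw [hΘ0] at hs hle
  refine ⟨hs, hle.trans ?_⟩
  -- the torus `L²` norms are the cell integrals of `X′²`, `X″²`
  have hint : ∀ α, ∫ x : UnitAddTorus d, ‖Θ α x‖ ^ 2 = ∫ y in Ioc (0 : ℝ) 1, (iteratedDeriv α X y) ^ 2 := by
    intro α
    simp only [hΘ]
    rw [integral_norm_sq_comp_eval_lift (hp α) (hc α) j]
    refine setIntegral_congr_fun measurableSet_Ioc fun y _ => ?_
    rw [norm_iteratedDeriv_ofReal_comp X.contDiff α y, sq_abs]
  have e1 : iteratedDeriv 1 (⇑X) = deriv ⇑X := iteratedDeriv_one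
  have e2 : iteratedDeriv 2 (⇑X) = deriv (deriv ⇑X) := by rw [iteratedDeriv_succ, iteratedDeriv_one]
  have hI1' : ∫ x : UnitAddTorus d, ‖Θ 1 x‖ ^ 2 ≤ I₁ := by rw [hint 1, e1]; exact hI₁
  have hI2' : ∫ x : UnitAddTorus d, ‖Θ 2 x‖ ^ 2 ≤ I₂ := by rw [hint 2, e2]; exact hI₂
  have hs1 := Real.sqrt_le_sqrt hI1'
  have hs2 := Real.sqrt_le_sqrt hI2'
  have hQ0 : 0 < Real.sqrt (2 * Q) := Real.sqrt_pos.mpr (by positivity)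
  gcongr

/-- **Periodic-cell moment against a fibrewise modulus** (drop-in variant of
`…SpectralMoments.tsum_modulus_mul_norm_mFourierCoeff_onCircle_le`): with `ω(q) = ω₁|q_j|` on the axis and `2M₀` off it,
`Σ_q ω(q)‖𝓕(x ↦ X(x_j))(q)‖ ≤ ω₁·(1/2π)(√(2Q)·√I₁ + √I₂/(Nπ√(2Q)))` for a `1/N`-periodic profile with cell integrals
`∫X′² ≤ I₁`, `∫X″² ≤ I₂`, every `Q ≥ 1`. [cite: Grafakos2014, Prop. 3.1.2 (5) and Prop. 3.2.7 (3)] -/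
theorem tsum_modulus_mul_norm_mFourierCoeff_onCircle_le_periodic (X : ShearProfile) (j : d) {N : ℕ} (hN : 1 ≤ N)
    (hXN : ∀ y, X (y + 1 / N) = X y) {I₁ I₂ M₀ ω₁ : ℝ} (hω₁ : 0 ≤ ω₁)
    (hI₁ : ∫ y in Ioc (0 : ℝ) 1, (deriv X y) ^ 2 ≤ I₁) (hI₂ : ∫ y in Ioc (0 : ℝ) 1, (deriv (deriv X) y) ^ 2 ≤ I₂)
    {Q : ℕ} (hQ : 1 ≤ Q) :
    (Summable fun q : d → ℤ => (if (∀ l, l ≠ j → q l = 0) then ω₁ * |(q j : ℝ)| else 2 * M₀) *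
      ‖mFourierCoeff (fun x : UnitAddTorus d => ((X.onCircle (x j) : ℝ) : ℂ)) q‖) ∧
    ∑' q : d → ℤ, (if (∀ l, l ≠ j → q l = 0) then ω₁ * |(q j : ℝ)| else 2 * M₀) *
      ‖mFourierCoeff (fun x : UnitAddTorus d => ((X.onCircle (x j) : ℝ) : ℂ)) q‖ ≤
      ω₁ * (1 / (2 * Real.pi) * (Real.sqrt (2 * Q) * Real.sqrt I₁ +
        Real.sqrt I₂ / ((N : ℝ) * (Real.pi * Real.sqrt (2 * Q))))) := by
  classical
  obtain ⟨hs, hle⟩ := tsum_abs_mul_norm_mFourierCoeff_onCircle_le_periodic X j hN hXN hI₁ hI₂ hQ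
  have heq : (fun q : d → ℤ => (if (∀ l, l ≠ j → q l = 0) then ω₁ * |(q j : ℝ)| else 2 * M₀) *
      ‖mFourierCoeff (fun x : UnitAddTorus d => ((X.onCircle (x j) : ℝ) : ℂ)) q‖) =
      fun q => ω₁ * (|(q j : ℝ)| * ‖mFourierCoeff (fun x : UnitAddTorus d => ((X.onCircle (x j) : ℝ) : ℂ)) q‖) := by
    funext q
    split_ifs with hq
    · ring
    · push Not at hq
      obtain ⟨l, hl, hql⟩ := hq
      rw [mFourierCoeff_onCircle_eq_zero_of_ne X j hl hql, norm_zero, mul_zero, mul_zero, mul_zero]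
  rw [heq]
  refine ⟨hs.mul_left ω₁, ?_⟩
  rw [tsum_mul_left]
  exact mul_le_mul_of_nonneg_left hle hω₁

end Summit.AnomalousDissipation.AnomalousDissipation.Theorems.SawtoothPulseCascade.K1Slot
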